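import Literature.NumberTheory.EllipticCurves.Zhai2021.TwoAdicLowerBoundTwists
import Literature.NumberTheory.EllipticCurves.CoatesLiTianZhai2015.QuadraticTwistsX049
import HarnessLib

/-!
# Zhai 2016, *Non-vanishing theorems for quadratic twists of elliptic curves* (Asian J. Math. 20): Thms. 1.1–1.5 AS PRINTED

HONEST FRAMING (cell `b2b-bsdres`, sub-lane `bsd-p2`, run/shared/lean/b2b/bsd-rank1-residual/p2/;
literature typer 1, mandate (iv), GEN 2 pass-2 on the explicit-valuation twist line; the printed
RANK-ZERO input `[Zhai2016]` of Kriz–Li 2019 Thm. 1.12 (2) / 5.1 (2) (`KrizLi2019/TwoPartBSDTwists.lean`)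
and the `r = 1` base of Cai–Li–Zhai 2020 (`CaiLiZhai2019/…`)): PUBLISHED theorems vendored as named
`Prop`s (nothing asserted, nothing discharged; D-0014), every printed hypothesis a binder — including the
paper's STANDING convention `(M, C) = 1` under which `L^{(alg)}(E^{(M)},1)` is defined — with locators
into the held text. EVIDENCE of what print says at `p = 2`: EXACT `2`-adic valuations `0` / `1` of
`L(E^{(M)},1)/Ω_∞(E^{(M)})` for quadratic twists of optimal curves, ANALYTIC RANK ZERO throughout
(`L(E^{(M)},1) ≠ 0` is a conclusion). Theorems 1.6–1.7 (lower bounds `ord₂ ≥ 1`) are recorded in this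
docstring only (support statements; no closing power). Nothing booked; no mark moved.

Source. S. Zhai, *Non-vanishing theorems for quadratic twists of elliptic curves*, Asian J. Math.
20 (2016) no. 3, 475–502, doi:10.4310/ajm.2016.v20.n3.a4 = arXiv:1409.0231 [Zhai2016]. Text read: the
held LaTeX-derived text `paper:arxiv-1409.0231` (3000-character chunks p0001–p0014; locators =
`chunk:line`; §1 = chunks p0002–p0004, §2 = p0005–p0006, §3 = p0007, §4 (Neumann–Setzer) = p0008–p0013).

## The printed statements (verbatim)

* Conventions (p0002 L3): "An elliptic curve over `ℚ` is optimal if it is an optimal quotient of the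
  corresponding modular curve. Every isogeny class contains a unique optimal curve." (p0002 L12–L18):
  "by the theorem of Manin-Drinfeld, we know that `φ([0])` is a torsion point on `E` … **For each square
  free integer `M`, prime to `C`, with `M ≡ 1 mod 4`, we define
  `L^{(alg)}(E^{(M)}, 1) = L(E^{(M)}, 1)/Ω_∞(E^{(M)})`, which is well known to be a rational number,
  where `Ω_∞(E^{(M)})` is the least real period of `E^{(M)}`.** We will always normalise the order
  valuation at `2` by `ord₂(2) = 1`. Let `F(x)` be the `2`-division polynomial of `E`. When `F(x)` is
  irreducible over `ℚ`, we define `F` to be the field obtained by adjoining to `ℚ` one fixed root of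
  `F(x)`. Let `q` be any prime of good reduction for `E`, and let `a_q` be the trace of Frobenius at `q`
  on `E` and denote `N_q := 1 + q − a_q`. … we define a rational prime `q` to be inert in the field `F`
  if it is unramified and there is a unique prime of `F` above `q`." (§2, p0005 L48): "We now let `Ω⁺`
  (`iΩ⁻`) denote the least positive real (imaginary) period of the Neron differential of a global
  minimal equation for `E`."
* **Theorem 1.1** (p0002 L22–L29): "Let `E` be a `Γ₀(C)`-optimal elliptic curve over `ℚ`, with negative
  discriminant, with `E[2](ℚ) = 0`, and satisfying `ord₂(L^{(alg)}(E,1)) = 0`. Let `M` be any integer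
  of the form `M = ε q₁q₂⋯q_r`, where `r ≥ 1`, `q₁, …, q_r` are arbitrary distinct odd primes which are
  inert in the field `F`, and the sign `ε = ±1` is chosen so that `M ≡ 1 mod 4`. Then we have
  `ord₂(L^{(alg)}(E^{(M)},1)) = 0`. In particular, `L(E^{(M)},s)` does not vanish at `s = 1`, and so
  `E^{(M)}(ℚ)` and `Ш(E^{(M)}(ℚ))` are finite." Remark (p0002 L31): with Boxer–Diao, the `2`-part of
  BSD for these twists under three FURTHER conditions (Sel₂-rank `0`; multiplicative bad reduction with
  odd `ord_p Δ`; good at `2` with `j ≡ 0 mod 2`) — a remark, not vendored. Examples: `X₀(11)`, `19A1`,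
  `26A1`, `26B1`, `121A1`, `121C1`.
* **Theorem 1.2** (p0003 L11–L18): "Let `E` be a `Γ₀(C)`-optimal elliptic curve over `ℚ`, with positive
  discriminant, with `E[2](ℚ) = 0`, and satisfying `ord₂(L^{(alg)}(E,1)) = 1`. Let `M` be any positive
  integer of the form `M = q₁q₂⋯q_r`, where `r ≥ 1`, `q₁, …, q_r` are arbitrary distinct odd primes
  which are inert in the the field `F`, and `M ≡ 1 mod 4`. Then we have `ord₂(L^{(alg)}(E^{(M)},1)) = 1`.
  In particular, `L(E^{(M)},s)` does not vanish at `s = 1`, and so `E^{(M)}(ℚ)` and `Ш(E^{(M)}(ℚ))` are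
  finite." Examples: `37B1`, `141E1`, `142D1`, `142E1`. (p0003 L46–L47): "entirely consistent with the
  `2`-part of [BSD], provided we know … that the `2`-primary subgroup of the Tate-Shafarevich group of
  the relevant twists is zero … it is not straightforward to carry out a classical `2`-descent on
  these curves because of our hypothesis that `E[2](ℚ) = 0`."
* **Theorem 1.3** (p0003 L51–L58): "Let `E` be a `Γ₀(C)`-optimal elliptic curve over `ℚ`, with negative
  discriminant. Let `M` be any integer of the form `M = ε q`, where `q` is an arbitrary odd prime, and
  the sign `ε = ±1` is chosen so that `M ≡ 1 mod 4`. Assume `L(E,1) ≠ 0`. If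
  `ord₂(N_q) = −ord₂(L^{(alg)}(E,1)) ≠ 0`, then we have `ord₂(L^{(alg)}(E^{(M)},1)) = 0`. In
  particular, `L(E^{(M)},s)` does not vanish at `s = 1`, and so `E^{(M)}(ℚ)` and `Ш(E^{(M)}(ℚ))` are
  finite." (p0003 L60: "we are assuming, in particular, that `ord₂(L^{(alg)}(E,1)) < 0`".)
* The Neumann–Setzer curves (p0003 L60–L64): "conductor `p`, where `p` is a prime of the form `u² + 64`
  for some integer `u ≡ 1 mod 4`, which have a minimal Weierstrass equation given by
  `A : y² + xy = x³ + ((u−1)/4) x² + 4x + u`." **Theorem 1.4** (p0003 L68–L75): "Let `q` be any prime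
  congruent to `3` modulo `4` and inert in `ℚ(√p)`. When `u ≡ 5 mod 8`, we have that
  `ord₂(L^{(alg)}(A^{(−q)},1)) = 0`. In particular, `L(A^{(−q)},s)` does not vanish at `s = 1`, and so
  `A^{(−q)}(ℚ)` is finite, the Tate-Shafarevich group `Ш(A^{(−q)}(ℚ))` is finite of odd cardinality,
  and the `2`-part of Birch and Swinnerton-Dyer conjecture is valid for `A^{(−q)}`." (§4, Thms. 4.9,
  4.10, Cor. 4.3–4.6 carry the `2`-descent.)
* **Theorem 1.5** (p0003 L105–L110, p0004 L1): "Let `E` be a `Γ₀(C)`-optimal elliptic curve over `ℚ`,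
  with positive discriminant. Let `q` be any odd prime with `q ≡ 1 mod 4`. Assume `L(E,1) ≠ 0`. If
  `ord₂(N_q) = 1 − ord₂(L^{(alg)}(E,1)) ≠ 0`, then we have `ord₂(L^{(alg)}(E^{(q)},1)) = 1`. In
  particular, `L(E^{(q)},s)` does not vanish at `s = 1`, and so `E^{(q)}(ℚ)` and `Ш(E^{(q)}(ℚ))` are
  finite." Examples: `X₀(21)`, `33A1`, `34A1`.
* Theorem 1.6 (p0004 L31–L36; NOT vendored): `E` optimal, `Δ < 0`, `L(E,1) ≠ 0`, `M = εq₁⋯q_r ≡ 1 (4)`,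
  `ord₂(N_{q_i}) > −ord₂(L^{(alg)}(E,1))` for at least one `i` ⇒ `ord₂(L^{(alg)}(E^{(M)},1)) ≥ 1`.
  Theorem 1.7 (p0004 L40–L45; NOT vendored): `E` optimal, `Δ > 0`, `L(E,1) ≠ 0`, `M ≠ 1`, `M ≡ 1 (4)` ⇒
  `ord₂(L^{(alg)}(E^{(M)},1)) ≥ 1`.

## The `p = 2` flag of this file

Natively AT 2, ANALYTIC RANK ZERO only; no parity-of-`p`, image or reduction-type-at-`2` exclusion.
Restricting hypotheses: `E` `Γ₀(C)`-optimal; `M ≡ 1 (mod 4)` square-free with `(M, C) = 1` (standing,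
p0002 L12 — so `2 ∤ M` and the twist is unramified at `2`); Thms. 1.1/1.2: `E[2](ℚ) = 0` and twisting
primes INERT in the cubic field `F` (`Frob_q` of order `3` on `E[2]`); Thms. 1.3/1.5: ONE twisting prime
with `ord₂(N_q) = −ord₂ L^{(alg)}(E,1)` resp. `= 1 − ord₂ L^{(alg)}(E,1)`, non-zero (so `E[2](ℚ) ≠ 0` is
expected, p0003 L60); Thm. 1.4: the explicit Neumann–Setzer curve with `u ≡ 5 (mod 8)`. The `2`-PART of
BSD is asserted in print ONLY in Thm. 1.4 (and in remarks for Thms. 1.3/1.5 examples "by a classical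
`2`-descent", not vendored). Relation to later print: Thm. 1.1 is a special case of
Adachi–Nomoto–Shii, Acta Arith. (2026) Thm. 4.2 (i) (their p0002 L47–L53); Cai–Li–Zhai 2020 Thm. 1.1 is
the multi-prime version of the `E[2](ℚ) ≅ ℤ/2` branch.

## Transcription (tree dictionary)

* `E` `Γ₀(C)`-optimal: a globally minimal `W`, `C = W.conductorNorm ℤ`, with a datum
  `Dt : ModularParametrizationData W C` satisfying `Zhai2021.IsOptimalDatum W Dt` (the lattice equality
  `Λ_E = ν_E Λ_f`, the tree's rendering of `X₀(C)`-optimality used by `Zhai2021/…`, `ShuZhai2021/…`,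
  `CaiLiZhai2019/…`). The Manin constant does not enter these statements.
* `Ω_∞(V)` = "the least (positive) real period" of the Néron lattice of a globally minimal `V` =
  `CoatesLiTianZhai2015.leastRealPeriod V` (`= realPeriodRat V / #components`); NOT the BSD period
  `realPeriodRat` (they differ by the factor `2` exactly when `Δ(V) > 0`, which is why Thm. 1.2 / 1.5
  read `ord₂ = 1`). `L(V,1)` = `V.entireLFunction 1`; "`ord₂(L^{(alg)}(V,1)) = k`" =
  `∃ x : ℚ, IsLAlg V x ∧ x ≠ 0 ∧ padicValRat 2 x = k` (`IsLAlg V x : L(V,1) = x · Ω_∞(V)`; rationality is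
  part of the printed conventions; `x ≠ 0` renders `ord₂ ≠ +∞`, printed as "in particular
  `L(E^{(M)},1) ≠ 0`").
* `E[2](ℚ) = 0` = `Nat.card {P // 2 • P = 0} = 1`; the cubic field `F` = any number field of degree `3`
  containing a root of the `2`-division cubic `4x³ + b₂x² + 2b₄x + b₆` of `W`
  (Mathlib `WeierstrassCurve.twoTorsionPolynomial`; its roots are the `x`-coordinates of the non-zero
  `2`-torsion points, so for `E[2](ℚ) = 0` it is irreducible and `F = ℚ(root)`; the field does not
  depend on the model) — `IsTwoDivisionField W F`; "`q` inert in `F`" (unramified with a unique prime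
  above) = the ideal `q𝓞_F` is prime — `IsInertIn F q`.
* `N_q = 1 + q − a_q` at a prime `q ∤ C` of good reduction = `reductionPointCount W q` (`= #Ẽ(𝔽_q)`).
* `M = ε q₁⋯q_r`, `ε` making `M ≡ 1 (mod 4)` = an integer `M` with `Squarefree M`, `M % 4 = 1`, whose set
  of prime factors `M.natAbs.primeFactors` is nonempty (`r ≥ 1`) and consists of odd primes with the
  printed property; `(M, C) = 1` = `Int.gcd M C = 1`; in Thm. 1.2 additionally `0 < M`.
* `E^{(M)}` = any globally minimal model `WM` of the tree's `W.quadraticTwist M` (pattern of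
  `CaiLiZhai2019` / `Zhai2021`); "`E^{(M)}(ℚ)` finite" = `Finite WM.toAffine.Point`; "`Ш` finite (of odd
  cardinality)" = `Finite WM.sha` (`∧ Odd WM.shaOrder`); "the `2`-part of BSD is valid" =
  `CaiLiZhai2019.pPartBSD WM 2`.
No `_holds` expected (Manin/Cremona modular-symbol formulas, integrality of the period lattice, Zhao's
induction; §4 a `2`-descent). Consumers take `(h : thm11_ordTwo_LAlg_twist_eq_zero)` etc.

## References
* [Zhai2016] Asian J. Math. 20 (2016) 475–502 = arXiv:1409.0231: §1 (chunks p0002–p0004) conventions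
  and Thms. 1.1–1.7; §2 (chunks p0005–p0006) modular symbols, `Ω^±`; §3 (chunk p0007) proofs of
  Thms. 1.1–1.3, 1.5; §4 (chunks p0008–p0013) Neumann–Setzer curves, Thm. 1.4 (= Thm. 4.10 ff.).
* [Zhai2021BSDExactFormulaTwists], [CaiLiZhai2019], [CoatesLiTianZhai2015] (tree files supplying the
  optimality rendering, `pPartBSD`, the twist-model pattern and `leastRealPeriod`).
-/

noncomputable section

open scoped Classical MatrixGroups ModularForm

open CongruenceSubgroup NumberField WeierstrassCurve Literature.NumberTheory.EllipticCurves
  Literature.NumberTheory.EllipticCurves.ModularForms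
  Literature.NumberTheory.EllipticCurves.CaiLiZhai2019
  Literature.NumberTheory.EllipticCurves.Zhai2021
  Literature.NumberTheory.EllipticCurves.CoatesLiTianZhai2015

namespace Literature.NumberTheory.EllipticCurves.Zhai2016

/-! ### §1. Vocabulary (definitions with bodies; nothing asserted) -/

/-- "`L^{(alg)}(V,1) = L(V,1)/Ω_∞(V)` … a rational number, where `Ω_∞(V)` is the least real period of
`V`": the rational `x` IS the algebraic `L`-value of the (globally minimal) model `V`, i.e.
`L(V,1) = x · Ω_∞(V)` with `Ω_∞ = leastRealPeriod` (least positive real Néron period).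
[cite: Zhai2016, §1 (arXiv:1409.0231 chunk p0002 L12–L18); §2 (chunk p0005 L48)] -/
def IsLAlg (V : WeierstrassCurve ℚ) (x : ℚ) : Prop :=
  V.entireLFunction 1 = (x : ℂ) * (leastRealPeriod V : ℂ)

/-- "`F` = the field obtained by adjoining to `ℚ` one fixed root of the `2`-division polynomial `F(x)`
of `E`" (when it is irreducible, i.e. `E[2](ℚ) = 0`): `F` is a number field of degree `3` containing a
root of the `2`-division cubic `4x³ + b₂x² + 2b₄x + b₆` of the model `W`
(`WeierstrassCurve.twoTorsionPolynomial`, whose roots are the `x`-coordinates of the non-zero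
`2`-torsion points). [cite: Zhai2016, §1 (chunk p0002 L18)] -/
def IsTwoDivisionField (W : WeierstrassCurve ℚ) (F : Type) [Field F] [NumberField F] : Prop :=
  Module.finrank ℚ F = 3 ∧ ∃ θ : F, Polynomial.aeval θ W.twoTorsionPolynomial.toPoly = 0

/-- "a rational prime `q` [is] inert in the field `F` if it is unramified and there is a unique prime
of `F` above `q`", i.e. the ideal `q𝓞_F` is a prime ideal. [cite: Zhai2016, §1 (chunk p0002 L18)] -/
def IsInertIn (F : Type) [Field F] [NumberField F] (q : ℕ) : Prop :=
  (Ideal.span {((q : ℤ) : RingOfIntegers F)}).IsPrime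

/-- The Neumann–Setzer curve "`A : y² + xy = x³ + ((u−1)/4) x² + 4x + u`" of prime conductor
`p = u² + 64`, `u ≡ 1 (mod 4)` (so `(u − 1)/4 ∈ ℤ`; for other `u` the integer division is a harmless
junk value). [cite: Zhai2016, §1 (chunk p0003 L60–L64); §4 (chunk p0008)] -/
def neumannSetzer (u : ℤ) : WeierstrassCurve ℚ :=
  ⟨1, (((u - 1) / 4 : ℤ) : ℚ), 0, 4, (u : ℚ)⟩

/-! ### §2. The printed theorems (named facts; nothing asserted) -/

/-- **Zhai 2016, Theorem 1.1** (verbatim in the module docstring). `E/ℚ` `Γ₀(C)`-optimal (globally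
minimal `W`, `C = N_E`, datum `Dt` with the lattice equality) with `Δ_E < 0`, `E[2](ℚ) = 0` and
`ord₂(L(E,1)/Ω_∞(E)) = 0`; `F` the cubic field of the `2`-division polynomial; `M` square-free,
`M ≡ 1 (mod 4)`, `(M, C) = 1` (standing convention), with `r ≥ 1` prime factors, all odd and inert in
`F`; `WM` a globally minimal model of `E^{(M)}`. Then `ord₂(L(E^{(M)},1)/Ω_∞(E^{(M)})) = 0`; in
particular `L(E^{(M)},1) ≠ 0` and `E^{(M)}(ℚ)`, `Ш(E^{(M)})` are finite. AT 2, analytic rank ZERO.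
No `_holds` expected. [cite: Zhai2016, Thm. 1.1 (arXiv:1409.0231 chunk p0002 L22–L29)] -/
def thm11_ordTwo_LAlg_twist_eq_zero : Prop :=
  ∀ (W : WeierstrassCurve ℚ) [W.IsElliptic] [W.IsGloballyMinimal] [NeZero (W.conductorNorm ℤ)]
    (Dt : ModularParametrizationData W (W.conductorNorm ℤ)), IsOptimalDatum W Dt →
    W.Δ < 0 → Nat.card {P : W.toAffine.Point // (2 : ℕ) • P = 0} = 1 →
    (∃ x : ℚ, IsLAlg W x ∧ x ≠ 0 ∧ padicValRat 2 x = 0) →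
    ∀ (F : Type) [Field F] [NumberField F], IsTwoDivisionField W F →
    ∀ (M : ℤ), Squarefree M → M % 4 = 1 → Int.gcd M (W.conductorNorm ℤ) = 1 →
      M.natAbs.primeFactors.Nonempty → (∀ q ∈ M.natAbs.primeFactors, q ≠ 2 ∧ IsInertIn F q) →
    ∀ (WM : WeierstrassCurve ℚ) [WM.IsElliptic] [WM.IsGloballyMinimal],
      (∃ C : VariableChange ℚ, C • W.quadraticTwist (M : ℚ) = WM) →
        (∃ x : ℚ, IsLAlg WM x ∧ x ≠ 0 ∧ padicValRat 2 x = 0) ∧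
        WM.entireLFunction 1 ≠ 0 ∧ Finite WM.toAffine.Point ∧ Finite WM.sha

/-- **Zhai 2016, Theorem 1.2** (verbatim in the module docstring). `E/ℚ` `Γ₀(C)`-optimal (globally
minimal `W`, datum `Dt` with the lattice equality) with `Δ_E > 0`, `E[2](ℚ) = 0` and
`ord₂(L(E,1)/Ω_∞(E)) = 1`; `F` the cubic field of the `2`-division polynomial; `M > 0` square-free,
`M ≡ 1 (mod 4)`, `(M, C) = 1` (standing convention), with `r ≥ 1` prime factors, all odd and inert
in `F`; `WM` a globally minimal model of `E^{(M)}`. Then `ord₂(L(E^{(M)},1)/Ω_∞(E^{(M)})) = 1`; in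
particular `L(E^{(M)},1) ≠ 0` and `E^{(M)}(ℚ)`, `Ш(E^{(M)})` are finite. (`Ω_∞` = LEAST real period:
here `Δ > 0` and `Ω_{BSD} = 2Ω_∞`.) AT 2, analytic rank ZERO. No `_holds` expected.
[cite: Zhai2016, Thm. 1.2 (arXiv:1409.0231 chunk p0003 L11–L18)] -/
def thm12_ordTwo_LAlg_twist_eq_one : Prop :=
  ∀ (W : WeierstrassCurve ℚ) [W.IsElliptic] [W.IsGloballyMinimal] [NeZero (W.conductorNorm ℤ)]
    (Dt : ModularParametrizationData W (W.conductorNorm ℤ)), IsOptimalDatum W Dt →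
    0 < W.Δ → Nat.card {P : W.toAffine.Point // (2 : ℕ) • P = 0} = 1 →
    (∃ x : ℚ, IsLAlg W x ∧ x ≠ 0 ∧ padicValRat 2 x = 1) →
    ∀ (F : Type) [Field F] [NumberField F], IsTwoDivisionField W F →
    ∀ (M : ℤ), 0 < M → Squarefree M → M % 4 = 1 → Int.gcd M (W.conductorNorm ℤ) = 1 →
      M.natAbs.primeFactors.Nonempty → (∀ q ∈ M.natAbs.primeFactors, q ≠ 2 ∧ IsInertIn F q) →
    ∀ (WM : WeierstrassCurve ℚ) [WM.IsElliptic] [WM.IsGloballyMinimal],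
      (∃ C : VariableChange ℚ, C • W.quadraticTwist (M : ℚ) = WM) →
        (∃ x : ℚ, IsLAlg WM x ∧ x ≠ 0 ∧ padicValRat 2 x = 1) ∧
        WM.entireLFunction 1 ≠ 0 ∧ Finite WM.toAffine.Point ∧ Finite WM.sha

/-- **Zhai 2016, Theorem 1.3** (verbatim in the module docstring). `E/ℚ` `Γ₀(C)`-optimal (globally
minimal `W`, datum `Dt` with the lattice equality) with `Δ_E < 0` and `L(E,1) ≠ 0`, of algebraic
`L`-value `x₀ = L(E,1)/Ω_∞(E)`; `q` an odd prime of good reduction (`q ∤ C`, where `N_q` is defined)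
with `ord₂(N_q) = −ord₂(x₀) ≠ 0`; `M = ε q` with `M ≡ 1 (mod 4)`; `WM` a globally minimal model of
`E^{(M)}`. Then `ord₂(L(E^{(M)},1)/Ω_∞(E^{(M)})) = 0`; in particular `L(E^{(M)},1) ≠ 0` and
`E^{(M)}(ℚ)`, `Ш(E^{(M)})` are finite. AT 2, analytic rank ZERO. No `_holds` expected.
[cite: Zhai2016, Thm. 1.3 (arXiv:1409.0231 chunk p0003 L51–L58)] -/
def thm13_ordTwo_LAlg_primeTwist_eq_zero : Prop :=
  ∀ (W : WeierstrassCurve ℚ) [W.IsElliptic] [W.IsGloballyMinimal] [NeZero (W.conductorNorm ℤ)]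
    (Dt : ModularParametrizationData W (W.conductorNorm ℤ)), IsOptimalDatum W Dt →
    W.Δ < 0 → W.entireLFunction 1 ≠ 0 →
    ∀ (x₀ : ℚ), IsLAlg W x₀ →
    ∀ (q : ℕ), q.Prime → q ≠ 2 → ¬ q ∣ W.conductorNorm ℤ →
      (padicValNat 2 (W.reductionPointCount q) : ℤ) = -padicValRat 2 x₀ →
      padicValNat 2 (W.reductionPointCount q) ≠ 0 →
    ∀ (M : ℤ), (M = q ∨ M = -q) → M % 4 = 1 →
    ∀ (WM : WeierstrassCurve ℚ) [WM.IsElliptic] [WM.IsGloballyMinimal],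
      (∃ C : VariableChange ℚ, C • W.quadraticTwist (M : ℚ) = WM) →
        (∃ x : ℚ, IsLAlg WM x ∧ x ≠ 0 ∧ padicValRat 2 x = 0) ∧
        WM.entireLFunction 1 ≠ 0 ∧ Finite WM.toAffine.Point ∧ Finite WM.sha

/-- **Zhai 2016, Theorem 1.4 (Neumann–Setzer twists)** (verbatim in the module docstring). `u ≡ 5
(mod 8)` with `p = u² + 64` prime; `A = neumannSetzer u` (`y² + xy = x³ + ((u−1)/4)x² + 4x + u`,
conductor `p`); `q ≡ 3 (mod 4)` a prime inert in `ℚ(√p)` (`CaiLiZhai2019.IsInertIn q p`); `WM` a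
globally minimal model of `A^{(−q)}`. Then `ord₂(L(A^{(−q)},1)/Ω_∞(A^{(−q)})) = 0`; in particular
`L(A^{(−q)},1) ≠ 0`, `A^{(−q)}(ℚ)` is finite, `Ш(A^{(−q)})` is finite of ODD cardinality, and the
`2`-part of BSD holds for `A^{(−q)}` (`pPartBSD WM 2`). AT 2, analytic rank ZERO, base curve good
ordinary at `2` with `A(ℚ)[2] ≠ 0`. No `_holds` expected.
[cite: Zhai2016, Thm. 1.4 (arXiv:1409.0231 chunk p0003 L60–L75); §4 Thms. 4.9–4.10, Cor. 4.3–4.6 (chunks p0011–p0012)] -/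
def thm14_neumannSetzer_twists : Prop :=
  ∀ (u : ℤ), u % 8 = 5 → (u ^ 2 + 64).natAbs.Prime →
    ∀ (q : ℕ), q.Prime → q % 4 = 3 → CaiLiZhai2019.IsInertIn q (u ^ 2 + 64) →
    ∀ (WM : WeierstrassCurve ℚ) [WM.IsElliptic] [WM.IsGloballyMinimal],
      (∃ C : VariableChange ℚ, C • (neumannSetzer u).quadraticTwist (-(q : ℚ)) = WM) →
        (∃ x : ℚ, IsLAlg WM x ∧ x ≠ 0 ∧ padicValRat 2 x = 0) ∧
        WM.entireLFunction 1 ≠ 0 ∧ Finite WM.toAffine.Point ∧ Finite WM.sha ∧ Odd WM.shaOrder ∧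
        pPartBSD WM 2

/-- **Zhai 2016, Theorem 1.5** (verbatim in the module docstring). `E/ℚ` `Γ₀(C)`-optimal (globally
minimal `W`, datum `Dt` with the lattice equality) with `Δ_E > 0` and `L(E,1) ≠ 0`, of algebraic
`L`-value `x₀ = L(E,1)/Ω_∞(E)`; `q ≡ 1 (mod 4)` a prime of good reduction (`q ∤ C`) with
`ord₂(N_q) = 1 − ord₂(x₀) ≠ 0`; `WM` a globally minimal model of `E^{(q)}`. Then
`ord₂(L(E^{(q)},1)/Ω_∞(E^{(q)})) = 1`; in particular `L(E^{(q)},1) ≠ 0` and `E^{(q)}(ℚ)`, `Ш(E^{(q)})`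
are finite. AT 2, analytic rank ZERO. No `_holds` expected.
[cite: Zhai2016, Thm. 1.5 (arXiv:1409.0231 chunk p0003 L105–L110, p0004 L1)] -/
def thm15_ordTwo_LAlg_primeTwist_eq_one : Prop :=
  ∀ (W : WeierstrassCurve ℚ) [W.IsElliptic] [W.IsGloballyMinimal] [NeZero (W.conductorNorm ℤ)]
    (Dt : ModularParametrizationData W (W.conductorNorm ℤ)), IsOptimalDatum W Dt →
    0 < W.Δ → W.entireLFunction 1 ≠ 0 →
    ∀ (x₀ : ℚ), IsLAlg W x₀ →
    ∀ (q : ℕ), q.Prime → q % 4 = 1 → ¬ q ∣ W.conductorNorm ℤ →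
      (padicValNat 2 (W.reductionPointCount q) : ℤ) = 1 - padicValRat 2 x₀ →
      padicValNat 2 (W.reductionPointCount q) ≠ 0 →
    ∀ (WM : WeierstrassCurve ℚ) [WM.IsElliptic] [WM.IsGloballyMinimal],
      (∃ C : VariableChange ℚ, C • W.quadraticTwist (q : ℚ) = WM) →
        (∃ x : ℚ, IsLAlg WM x ∧ x ≠ 0 ∧ padicValRat 2 x = 1) ∧
        WM.entireLFunction 1 ≠ 0 ∧ Finite WM.toAffine.Point ∧ Finite WM.sha

/-! ### §3. Bookkeeping (proved) -/

/-- `IsLAlg` unfolded (by definition). [cite: Zhai2016, §1 (chunk p0002 L12–L18)] -/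
theorem isLAlg_iff (V : WeierstrassCurve ℚ) (x : ℚ) :
    IsLAlg V x ↔ V.entireLFunction 1 = (x : ℂ) * (leastRealPeriod V : ℂ) :=
  Iff.rfl

/-- A non-zero algebraic `L`-value means `L(V,1) ≠ 0` as soon as the least real period is non-zero
(the printed "In particular, `L(E^{(M)},s)` does not vanish at `s = 1`").
[cite: Zhai2016, Thm. 1.1 (chunk p0002 L29)] -/
theorem entireLFunction_one_ne_zero_of_isLAlg {V : WeierstrassCurve ℚ} {x : ℚ} (h : IsLAlg V x)
    (hx : x ≠ 0) (hΩ : leastRealPeriod V ≠ 0) : V.entireLFunction 1 ≠ 0 := by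
  rw [h]
  exact mul_ne_zero (by exact_mod_cast hx) (by exact_mod_cast hΩ)

/-- The coefficients of the Neumann–Setzer model: `a₁ = 1`, `a₃ = 0`, `a₄ = 4`, `a₆ = u`.
[cite: Zhai2016, §1 (chunk p0003 L60–L64)] -/
theorem neumannSetzer_a (u : ℤ) :
    (neumannSetzer u).a₁ = 1 ∧ (neumannSetzer u).a₃ = 0 ∧ (neumannSetzer u).a₄ = 4 ∧
      (neumannSetzer u).a₆ = u :=
  ⟨rfl, rfl, rfl, rfl⟩

/-- For `u ≡ 1 (mod 4)` the model `neumannSetzer u` has `b₂ = u` and discriminant `−(u² + 64)²`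
(so `Δ < 0`, the setting of Thm. 1.3, and the only bad prime is `p = u² + 64`).
[cite: Zhai2016, §1 (chunk p0003 L60–L64: "conductor p … p = u² + 64")] -/
theorem neumannSetzer_Δ (u : ℤ) (hu : u % 4 = 1) :
    (neumannSetzer u).Δ = -(((u : ℚ) ^ 2 + 64) ^ 2) := by
  obtain ⟨k, rfl⟩ : ∃ k : ℤ, u = 4 * k + 1 := ⟨(u - 1) / 4, by omega⟩
  have hk' : (4 * k + 1 - 1) / 4 = k := by omega
  simp only [neumannSetzer, hk', WeierstrassCurve.Δ, WeierstrassCurve.b₂, WeierstrassCurve.b₄,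
    WeierstrassCurve.b₆, WeierstrassCurve.b₈]
  push_cast
  ring

end Literature.NumberTheory.EllipticCurves.Zhai2016

end
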